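/-
Copyright: the b2b-balaban T⁴-continuum CRUX team, row NE7b OWNER lineage `t4-ne7b-p1` (gen 131). Project licence.
-/
import Summits.QuantumFields.BalabanUV.T4Continuum.Spine.NE7b.SupTiltedLinearCovariance
import Summits.QuantumFields.BalabanUV.T4Continuum.Spine.NE7b.SupTiltedCovarianceDecay
import Summits.QuantumFields.BalabanUV.T4Continuum.Spine.NE7b.SupCellGraphDistance
import Summits.QuantumFields.BalabanUV.T4Continuum.Spine.NE7b.SupSmallFieldGasReal

/-!
# LINEAR OBSERVABLES DECORRELATE EXPONENTIALLY IN THE CELL DISTANCE (nonnegative class): for the road's step over the cells of `S` with a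
# finite-range Gaussian (`Γ_{yx} = 0` beyond `ρ`, `ρ`-close sites in equal or `R`-adjacent cells, rows `Σ_x|Γ_{yx}| ≤ γ₁`), a site `y ∈ cell p₀`
# and a one-site observable `G₀` at `z ∈ cell p₁` with `dist_R(p₀,p₁) = m ≥ 3`, (346)'s Stein reduction
#   `Cov_ν(ω_y, G_z) = Γ_{yz}E_ν[G₀′] − Σ_{x}Γ_{yx}Cov_ν(w′_x, G_z)`
# has `Γ_{yz} = 0`, only sites `x` in cells at distance `≤ 1` from `p₀` contribute, and each `Cov_ν(w′_x, G_z)` is a ONE-SITE covariance at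
# cell distance `≥ m − 1` — so with a far letter `|Cov_ν(w′_x,G_z)| ≤ C·e^{−η(k+1)∕4}` at distance `2 + k` ((332c) with (340)'s graph
# potential, §2):   `|Cov_ν(ω_y, G_z)| ≤ γ₁·C·e^{−η(m−2)∕4}` — SCOPING-d4's item (b) CLOSED for the nonnegative class
# (row NE7b, node U5c; (346)∕(332c)∕(340) BY NAME; [folklore])

Cell `pub-balaban`, sub-cell `t4`, spine estimate NE7b (`T4WeightBudget.RelWeightBound`; the cell's OWN estimate — NOT PRINTED in
[Bałaban 1983–89], NOT PROVED).  Crux-route work under `Spine/NE7b/` by the row OWNER (`t4-ne7b-p1` gen 131, file (347)) under FREEZE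
(0)'s crux-prover clause, on § [NE7bP1-G130-HANDOFF] NEXT (3)(b); NOTHING of Bałaban's is named as a Lean object, valued or asserted; no
`T4Continuum/Support` leaf typed; no `def`, no notation; zero `sorry`.  Imports (BY NAME): the OWNER's (346) `…SupTiltedLinearCovariance`
(`tilted_cov_linear`, `lineZ_pos'`), (332c) `…SupTiltedCovarianceDecay` (`abs_tilted_cov_decay`), (340) `…SupCellGraphDistance`
(`dist_le_dist_add_one_of_rel`, `dist_self_zero`), (297) (`cellSum_eq_sum_biUnion`); the tree's `HasFiniteRange`; Mathlib's
`SimpleGraph.Reachable.dist_triangle_right`, `SimpleGraph.dist_eq_one_iff_adj`.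

WHAT IS PROVED ([folklore]):
* §1 `cov_div_eq` (`J∕Z − (I∕Z)(I_G∕Z) = (J·Z − I·I_G)∕Z²`), `dist_le_one_of_rel` (equal or adjacent cells are at graph distance `≤ 1`),
  `abs_sum_mul_le` (a row against uniformly bounded terms);
* §2 THE FAR LETTER BY NAME **`far_cov_letter`** ((332c) with `F := w′`, `G := G₀`, the graph-distance potential from the cell of `x`, `n = k`
  for cells at distance `2 + k`);
* §3 THE END **`abs_cov_linear_le`** (abstract far letter `C`: `Γ` of finite range with `ρ`-close sites in equal-or-adjacent cells, row letter
  `γ₁`, connected cell graph, `3 ≤ m = dist(p₀,p₁)` ⟹ `|Cov_ν(ω_y, G_z)| ≤ γ₁·C·e^{−η((m−3)+1)∕4}`); §4 toy.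

HONEST (what this is NOT).  Nonnegative class only (e^{−V} ≤ 1 for the Stein identity; the stable class needs (288)'s tilt first); the far
letter is kept abstract in the END and discharged by name in §2 (the road's giant constant stays out of the assembly, pattern of (342));
scalar skeleton ((A3), NC-NE7b-α UNRULED); nothing of Bałaban's asserted.  BY-NAME EFFECT ON THE WALL: NONE.  NE7b NOT PRINTED ∕ NOT PROVED;
spine PROVED 0∕9; rung (B)+1 — the programme's measures remain FINITE-torus statements; NOT the mass gap, NOT Clay.  HONEST DEPENDENCY:
continuum YM on T⁴ ⇐ BetaPertH ∧ nine spine estimates (0∕9 proved); BetaPertH ⇐ (D1) ∧ (D4) ∧ CAP+tail; G-an2-4 gates asym, D1 and NE2∕3∕4.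
-/

set_option autoImplicit false

noncomputable section

namespace Summit.QuantumFields.BalabanUV.T4Continuum.NE7b.SupTiltedLinearCovarianceDecay

open MeasureTheory ProbabilityTheory Finset Real
open scoped BigOperators
open Literature.Analysis.Matrix (HasFiniteRange)
open SupTiltedLinearCovariance (tilted_cov_linear lineZ_pos')
open SupTiltedCovarianceDecay (abs_tilted_cov_decay)
open SupCellGraphDistance (dist_le_dist_add_one_of_rel dist_self_zero)
open SupSmallFieldGasReal (cellSum_eq_sum_biUnion)

variable {ι : Type} [Fintype ι] [DecidableEq ι] {V : Type*} [DecidableEq V]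

/-! ## §1. Bookkeeping -/

omit [Fintype ι] [DecidableEq ι] [DecidableEq V] in
/-- `Z ≠ 0` ⟹ `J∕Z − (I∕Z)(I_G∕Z) = (J·Z − I·I_G)∕Z²`. [folklore] -/
theorem cov_div_eq {Z J I IG : ℝ} (hZ : Z ≠ 0) : J / Z - I / Z * (IG / Z) = (J * Z - I * IG) / Z ^ 2 := by
  field_simp

omit [Fintype ι] [DecidableEq ι] [DecidableEq V] in
/-- Equal or `R`-related cells are at graph distance `≤ 1`. [folklore] -/
theorem dist_le_one_of_rel {R : V → V → Prop} {p q : V} (h : p = q ∨ R p q) : (SimpleGraph.fromRel R).dist p q ≤ 1 := by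
  rcases h with rfl | hR
  · rw [SimpleGraph.dist_self]; exact zero_le_one
  · by_cases hpq : p = q
    · subst hpq; rw [SimpleGraph.dist_self]; exact zero_le_one
    · exact (SimpleGraph.dist_eq_one_iff_adj.2 ((SimpleGraph.fromRel_adj R p q).2 ⟨hpq, Or.inl hR⟩)).le

omit [Fintype ι] [DecidableEq ι] [DecidableEq V] in
/-- A row against uniformly bounded terms: `|t_x| ≤ B` whenever `g_x ≠ 0`, `B ≥ 0`, `Σ|g_x| ≤ γ₁` ⟹ `|Σ g_x t_x| ≤ γ₁·B`. [folklore] -/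
theorem abs_sum_mul_le (Y : Finset ι) (g t : ι → ℝ) {B γ₁ : ℝ} (hB : 0 ≤ B) (ht : ∀ x ∈ Y, g x ≠ 0 → |t x| ≤ B)
    (hrow : ∑ x ∈ Y, |g x| ≤ γ₁) : |∑ x ∈ Y, g x * t x| ≤ γ₁ * B := by
  refine (abs_sum_le_sum_abs _ _).trans ?_
  have hpt : ∀ x ∈ Y, |g x * t x| ≤ |g x| * B := fun x hx => by
    rw [abs_mul]
    by_cases hg : g x = 0
    · rw [hg, abs_zero, zero_mul, zero_mul]
    · exact mul_le_mul_of_nonneg_left (ht x hx hg) (abs_nonneg _)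
  refine (sum_le_sum hpt).trans ?_
  rw [← sum_mul]
  exact mul_le_mul_of_nonneg_right hrow hB

section Main

variable {Γ : Matrix ι ι ℝ} {γop γ : ℝ} {dι : ι → ι → ℕ} {ρ : ℕ} {cell : V → Finset ι} {v : ℕ} {R : V → V → Prop}
  [DecidableRel R] [Std.Symm R] {nbr : V → Finset V} {Δ : ℕ} {w w' : ι → ℝ → ℝ} {G₀ G₀' : ℝ → ℝ}
  {κ₀ κ₁ c₂ c₃ h κ τ θ Ψ δ₀ η c : ℝ} {m : ℕ}

/-! ## §2. The far letter by name -/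

/-- **THE FAR LETTER** ((332c) with `F := w′`, `G := G₀`, the graph-distance potential from the cell `p'` of `x` ((340)), `n = k` for
`dist(p', p₁) = 2 + k`): the one-site covariance `Cov_ν(w′_x, G_z)` in (332c)'s normal form is `≤ C·e^{−η(k+1)∕4}`. [folklore] -/
theorem far_cov_letter (hΓ : Γ.PosSemidef) (hΓop : (γop • (1 : Matrix ι ι ℝ) - Γ).PosSemidef) (hdiag : ∀ i, Γ i i ≤ γ) (hγ : 0 ≤ γ)
    (hfr : HasFiniteRange dι ρ Γ) (hdisj : ∀ p q, p ≠ q → Disjoint (cell p) (cell q)) (hv : ∀ p, (cell p).card ≤ v)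
    (hR : ∀ (p p' : V) (x y : ι), x ∈ cell p → y ∈ cell p' → dι x y ≤ ρ → p = p' ∨ R p p') (hΔ : ∀ x, (nbr x).card ≤ Δ)
    (hnbr : ∀ x y, R x y → y ∈ nbr x) (hw : ∀ x, Measurable (w x)) (hw'm : ∀ x, Measurable (w' x)) (hG₀m : Measurable G₀) (hκ₀ : 0 ≤ κ₀)
    (hc₂ : 0 ≤ c₂) (hc₃ : 0 ≤ c₃) (hh : 0 ≤ h) (hδ₀ : 0 < δ₀) (hstab : ∀ x, ∀ u : ℝ, -(κ₀ * u ^ 2) ≤ w x u)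
    (hcub : ∀ x, ∀ u : ℝ, |u| ≤ h → |w x u| ≤ c₃ * |u| ^ 3) (hw'q : ∀ x u, |w' x u| ≤ c₂ * u ^ 2) (hG₀q : ∀ u, |G₀ u| ≤ c₂ * u ^ 2)
    (hκ : 2 * ((κ₀ + 2 * c₂) + δ₀) ≤ κ) (hτ : 0 < τ) (hθ0 : 0 < θ) (hθ1 : θ < 1) (hκθ : κ * (1 + τ) * γop ≤ θ)
    (hκθ₈ : 2 * (κ₀ + 2 * (4 * c₂)) * (1 + τ) * γop ≤ θ) (S : Finset V) (ψ₀ : EuclideanSpace ℝ ι)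
    (hψ : ∀ p ∈ S, ∑ x ∈ cell p, ψ₀ x ^ 2 ≤ Ψ ^ 2) {p₁ : V} (hp₁ : p₁ ∈ S) {z : ι} (hz : z ∈ cell p₁) (hη : 0 ≤ η)
    (hsmall₂ : Real.exp (1 + η) * (((max (exp (v * (c₃ * h ^ 3 + 2 * c₂ * h ^ 2)) - 1) (2 * exp (-((κ / 2 - (κ₀ + 2 * c₂)) * h ^ 2)))) *
      exp (κ * (1 + τ⁻¹) * Ψ ^ 2 / 2)) * ((1 - θ) ^ (-(κ * (1 + τ) * γ / (2 * θ)))) ^ v) * ((Δ : ℝ) + 1) ^ 2 ≤ 1 / 2)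
    (hsmall : Real.exp 1 * (((max (exp (v * ((c₃ * h ^ 3 + 2 * c₂ * h ^ 2) + δ₀ * h ^ 2)) - 1)
      (2 * exp (-((κ / 2 - ((κ₀ + 2 * c₂) + δ₀)) * h ^ 2)))) * exp (κ * (1 + τ⁻¹) * Ψ ^ 2 / 2)) *
      ((1 - θ) ^ (-(κ * (1 + τ) * γ / (2 * θ)))) ^ v) * ((Δ : ℝ) + 1) ^ 2 ≤ 1 / 2) {M : ℝ}
    (hM : exp (2 * ((1 : ℝ) * ((Δ : ℝ) + 1) * (2 * (Real.exp 1 *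
        (((max (exp (v * ((c₃ * h ^ 3 + 2 * c₂ * h ^ 2) + δ₀ * h ^ 2)) - 1) (2 * exp (-((κ / 2 - ((κ₀ + 2 * c₂) + δ₀)) * h ^ 2)))) *
          exp (κ * (1 + τ⁻¹) * Ψ ^ 2 / 2)) * ((1 - θ) ^ (-(κ * (1 + τ) * γ / (2 * θ)))) ^ v))))) ≤ M) :
    ∀ x ∈ S.biUnion cell, ∀ p' ∈ S, x ∈ cell p' → ∀ k : ℕ, (SimpleGraph.fromRel R).dist p' p₁ = 2 + k →
      |(((∫ ω : EuclideanSpace ℝ ι, exp (-(∑ p ∈ S, ∑ x ∈ cell p, w x (ω x + ψ₀ x))) * w' x (ω x + ψ₀ x) * G₀ (ω z + ψ₀ z) ∂(multivariateGaussian 0 Γ)) *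
          (∫ ω : EuclideanSpace ℝ ι, exp (-(∑ p ∈ S, ∑ x ∈ cell p, w x (ω x + ψ₀ x))) ∂(multivariateGaussian 0 Γ)) -
        (∫ ω : EuclideanSpace ℝ ι, exp (-(∑ p ∈ S, ∑ x ∈ cell p, w x (ω x + ψ₀ x))) * w' x (ω x + ψ₀ x) ∂(multivariateGaussian 0 Γ)) *
          (∫ ω : EuclideanSpace ℝ ι, exp (-(∑ p ∈ S, ∑ x ∈ cell p, w x (ω x + ψ₀ x))) * G₀ (ω z + ψ₀ z) ∂(multivariateGaussian 0 Γ))) /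
        (∫ ω : EuclideanSpace ℝ ι, exp (-(∑ p ∈ S, ∑ x ∈ cell p, w x (ω x + ψ₀ x))) ∂(multivariateGaussian 0 Γ)) ^ 2)| ≤
        (4 * ((1 : ℝ) * ((Δ : ℝ) + 1) * (2 * (Real.exp (1 + η) *
          (((max (exp (v * (c₃ * h ^ 3 + 2 * c₂ * h ^ 2)) - 1) (2 * exp (-((κ / 2 - (κ₀ + 2 * c₂)) * h ^ 2)))) *
            exp (κ * (1 + τ⁻¹) * Ψ ^ 2 / 2)) * ((1 - θ) ^ (-(κ * (1 + τ) * γ / (2 * θ)))) ^ v)))) +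
          ((2 * c₂ ^ 2 * (δ₀ ^ 2)⁻¹ * M) + (c₂ * δ₀⁻¹ * M) ^ 2) + ((6 * c₂ ^ 3 * (δ₀ ^ 3)⁻¹ * M) + (c₂ * δ₀⁻¹ * M) * (2 * c₂ ^ 2 * (δ₀ ^ 2)⁻¹ * M) +
          2 * (2 * c₂ ^ 2 * (δ₀ ^ 2)⁻¹ * M) * (c₂ * δ₀⁻¹ * M) + 2 * (c₂ * δ₀⁻¹ * M) * (c₂ * δ₀⁻¹ * M) ^ 2) / 2) * exp (-(η * ((k : ℝ) + 1)) / 4) :=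
  fun x _ p' hp' hxp' k hk =>
  abs_tilted_cov_decay (F := w') (G := fun _ => G₀) hΓ hΓop hdiag hγ hfr hdisj hv hR hΔ hnbr hw hw'm (fun _ => hG₀m) hκ₀ hc₂ hc₃ hh hδ₀
    hstab hcub hw'q (fun _ => hG₀q) hκ hτ hθ0 hθ1 hκθ hκθ₈ S ψ₀ hψ hp' hp₁ hxp' hz (d := fun q => (SimpleGraph.fromRel R).dist p' q)
    (fun p q hpq => dist_le_dist_add_one_of_rel p' hpq) (n := k) (dist_self_zero p') (by show k + 2 ≤ (SimpleGraph.fromRel R).dist p' p₁; omega) hη hsmall₂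
    hsmall hM

/-! ## §3. THE END: linear observables decorrelate -/

omit [DecidableEq V] [DecidableRel R] [Std.Symm R] in
/-- **LINEAR OBSERVABLES DECORRELATE EXPONENTIALLY IN THE CELL DISTANCE.**  Hypotheses of (346) `tilted_cov_linear` on `Y = ⋃_S cells`
(nonnegative `C¹` remainders with `|w′| ≤ κ₁|u|`, a `C¹` observable `G₀` of polynomial growth at `z`), an ABSTRACT far letter `C ≥ 0` for the
one-site covariances `Cov_ν(w′_x, G_z)` at cell distance `2 + k` (§2), `Γ` of finite range `ρ` with `ρ`-close sites in equal-or-`R`-related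
cells, the row letter `Σ_x|Γ_{yx}| ≤ γ₁`, a connected cell graph, `y ∈ cell p₀`, `z ∈ cell p₁`, `dist(p₀,p₁) = 3 + n₀` ⟹
`|E_ν[ω_yG_z] − E_ν[ω_y]E_ν[G_z]| ≤ γ₁·C·e^{−η((m−3)+1)∕4}`. [folklore] -/
theorem abs_cov_linear_le (hΓ : Γ.PosSemidef) (hfr : HasFiniteRange dι ρ Γ) (hdisj : ∀ p q, p ≠ q → Disjoint (cell p) (cell q))
    (hR : ∀ (p p' : V) (x y : ι), x ∈ cell p → y ∈ cell p' → dι x y ≤ ρ → p = p' ∨ R p p')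
    (hconn : ∀ p q : V, (SimpleGraph.fromRel R).Reachable p q)
    (hwC : ∀ x, ContDiff ℝ 1 (w x)) (hw' : ∀ x t, HasDerivAt (w x) (w' x t) t) (hw'm : ∀ x, Measurable (w' x))
    (hw0 : ∀ x t, 0 ≤ w x t) (hκ₁ : 0 ≤ κ₁) (hw'b : ∀ x t, |w' x t| ≤ κ₁ * |t|)
    (hGC : ContDiff ℝ 1 G₀) (hG' : ∀ t, HasDerivAt G₀ (G₀' t) t) (hG'm : Measurable G₀') (hc : 0 ≤ c)
    (hGg : ∀ t, |G₀ t| ≤ c * (1 + |t|) ^ m) (hG'g : ∀ t, |G₀' t| ≤ c * (1 + |t|) ^ m)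
    (S : Finset V) (ψ₀ : EuclideanSpace ℝ ι) {p₀ p₁ : V} {y z : ι} (hy : y ∈ cell p₀) (hz : z ∈ cell p₁)
    {γ₁ : ℝ} (hrow : ∑ x ∈ S.biUnion cell, |Γ y x| ≤ γ₁) {C : ℝ} (hC : 0 ≤ C) (hη : 0 ≤ η) {n₀ : ℕ} (hm : (SimpleGraph.fromRel R).dist p₀ p₁ = 3 + n₀)
    (hfar : ∀ x ∈ S.biUnion cell, ∀ p' ∈ S, x ∈ cell p' → ∀ k : ℕ, (SimpleGraph.fromRel R).dist p' p₁ = 2 + k →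
      |(((∫ ω : EuclideanSpace ℝ ι, exp (-(∑ p ∈ S, ∑ x ∈ cell p, w x (ω x + ψ₀ x))) * w' x (ω x + ψ₀ x) * G₀ (ω z + ψ₀ z) ∂(multivariateGaussian 0 Γ)) *
          (∫ ω : EuclideanSpace ℝ ι, exp (-(∑ p ∈ S, ∑ x ∈ cell p, w x (ω x + ψ₀ x))) ∂(multivariateGaussian 0 Γ)) -
        (∫ ω : EuclideanSpace ℝ ι, exp (-(∑ p ∈ S, ∑ x ∈ cell p, w x (ω x + ψ₀ x))) * w' x (ω x + ψ₀ x) ∂(multivariateGaussian 0 Γ)) *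
          (∫ ω : EuclideanSpace ℝ ι, exp (-(∑ p ∈ S, ∑ x ∈ cell p, w x (ω x + ψ₀ x))) * G₀ (ω z + ψ₀ z) ∂(multivariateGaussian 0 Γ))) /
        (∫ ω : EuclideanSpace ℝ ι, exp (-(∑ p ∈ S, ∑ x ∈ cell p, w x (ω x + ψ₀ x))) ∂(multivariateGaussian 0 Γ)) ^ 2)| ≤ C * exp (-(η * ((k : ℝ) + 1)) / 4)) :
    |(∫ ω : EuclideanSpace ℝ ι, ω y * (exp (-(∑ x' ∈ S.biUnion cell, w x' (ω x' + ψ₀ x'))) * G₀ (ω z + ψ₀ z)) ∂(multivariateGaussian 0 Γ)) /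
          (∫ ω : EuclideanSpace ℝ ι, exp (-(∑ x' ∈ S.biUnion cell, w x' (ω x' + ψ₀ x'))) ∂(multivariateGaussian 0 Γ)) -
        (∫ ω : EuclideanSpace ℝ ι, ω y * exp (-(∑ x' ∈ S.biUnion cell, w x' (ω x' + ψ₀ x'))) ∂(multivariateGaussian 0 Γ)) /
            (∫ ω : EuclideanSpace ℝ ι, exp (-(∑ x' ∈ S.biUnion cell, w x' (ω x' + ψ₀ x'))) ∂(multivariateGaussian 0 Γ)) *
          ((∫ ω : EuclideanSpace ℝ ι, exp (-(∑ x' ∈ S.biUnion cell, w x' (ω x' + ψ₀ x'))) * G₀ (ω z + ψ₀ z) ∂(multivariateGaussian 0 Γ)) /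
            (∫ ω : EuclideanSpace ℝ ι, exp (-(∑ x' ∈ S.biUnion cell, w x' (ω x' + ψ₀ x'))) ∂(multivariateGaussian 0 Γ)))| ≤
      γ₁ * (C * exp (-(η * ((n₀ : ℝ) + 1)) / 4)) := by
  -- (346)'s Stein reduction on `Y = ⋃_S cells` with `ψ = ψ₀`
  rw [tilted_cov_linear (S.biUnion cell) (fun x => ψ₀ x) y z hΓ hwC hw' hw'm hw0 hκ₁ hw'b hGC hG' hG'm hc hGg hG'g]
  -- `Γ_yz = 0`: `z` is not `ρ`-close to `y`
  have hyz : Γ y z = 0 := by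
    refine hfr y z (not_le.1 fun hle => ?_)
    have h1 := dist_le_one_of_rel (hR p₀ p₁ y z hy hz hle)
    omega
  rw [hyz, zero_mul, zero_sub, abs_neg]
  -- each contributing `x` sits in a cell at distance `≤ 1` from `p₀`, hence `≥ m − 1` from `p₁`
  have hwm : ∀ x, Measurable (w x) := fun x => (hwC x).continuous.measurable
  obtain ⟨-, hZ⟩ := lineZ_pos' Γ (S.biUnion cell) hwm hw0 (fun x => ψ₀ x)
  refine abs_sum_mul_le (S.biUnion cell) (fun x => Γ y x) _ (by positivity) (fun x hx hgx => ?_) hrow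
  have hle : dι y x ≤ ρ := not_lt.1 fun hlt => hgx (hfr y x hlt)
  obtain ⟨p', hp', hxp'⟩ := mem_biUnion.1 hx
  have hd0 : (SimpleGraph.fromRel R).dist p₀ p' ≤ 1 := dist_le_one_of_rel (hR p₀ p' y x hy hxp' hle)
  have htri : (SimpleGraph.fromRel R).dist p₀ p₁ ≤ (SimpleGraph.fromRel R).dist p₀ p' + (SimpleGraph.fromRel R).dist p' p₁ := (hconn p' p₁).dist_triangle_right p₀
  obtain ⟨k, hk⟩ : ∃ k : ℕ, (SimpleGraph.fromRel R).dist p' p₁ = 2 + k := ⟨(SimpleGraph.fromRel R).dist p' p₁ - 2, by omega⟩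
  have key := hfar x hx p' hp' hxp' k hk
  -- the covariance in (332c)'s normal form, on `⋃_S cells`
  simp only [cellSum_eq_sum_biUnion cell hdisj S] at key
  have eJ : (∫ ω : EuclideanSpace ℝ ι, exp (-(∑ x' ∈ S.biUnion cell, w x' (ω x' + ψ₀ x'))) * w' x (ω x + ψ₀ x) * G₀ (ω z + ψ₀ z) ∂(multivariateGaussian 0 Γ)) =
      (∫ ω : EuclideanSpace ℝ ι, exp (-(∑ x' ∈ S.biUnion cell, w x' (ω x' + ψ₀ x'))) * (G₀ (ω z + ψ₀ z) * w' x (ω x + ψ₀ x)) ∂(multivariateGaussian 0 Γ)) := integral_congr_ae (ae_of_all _ fun ω => by ring)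
  rw [eJ] at key
  rw [cov_div_eq hZ.ne']
  refine key.trans (mul_le_mul_of_nonneg_left (exp_le_exp.2 ?_) hC)
  have hk' : (n₀ : ℝ) ≤ k := by exact_mod_cast (by omega : n₀ ≤ k)
  nlinarith

end Main

/-! ## §4. Toy -/

/-- Toy (§1): a vanishing row gives a vanishing bound. -/
example (t : Fin 2 → ℝ) : |∑ x ∈ (Finset.univ : Finset (Fin 2)), (0 : ℝ) * t x| ≤ 0 * 1 :=
  abs_sum_mul_le Finset.univ (fun _ => 0) t zero_le_one (fun x _ h => absurd rfl h) (by simp)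

end Summit.QuantumFields.BalabanUV.T4Continuum.NE7b.SupTiltedLinearCovarianceDecay
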